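import Literature.AlgebraicGeometry.Resolution.QuadraticTransformsProofs
import Summits.ResolutionOfSingularities.ResolutionOfSingularities.Theorems.ValuativeLuAlphaPTorsorCurveMonomializationStep

/-!
# The free `π`-chart regime of the quadratic sequence along a discrete rank-one valuation

Helper file for the line `pfaff-line-log-final-forms` of the crux `Valuative.LuAlphaPTorsor`
(item `stmt-ResolutionOfSingularities-0641`), immediate case along DISCRETE rank-one valuations
(registered helper stub `discreteSequence_freeRegime`).

Let `R₀ → R₁ → ⋯` be the quadratic sequence of a two-dimensional regular local ring `R₀` of the
field `K` along a valuation ring `O` dominating `R₀` (Cutkosky 2014, §2.2; tree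
`QuadraticTransforms*.lean`), and let `π ∈ 𝔪_O` be such that every non-zero value is an integral
power of `v(π)` (so `O` is discrete of rank one and `v(π)` is the largest value `< 1`). PROVED
(`discreteSequence_freeRegime`): from some stage `i₀` on,

* `π ∈ Rᵢ` (Abhyankar's union lemma `O = ⋃ Rᵢ`, `AbhyankarQuadraticUnion_holds`);
* every non-unit `z` of `Rᵢ` has `z/π ∈ R_{i+1}` (`π` has the largest value among the non-units of
  `Rᵢ`, so it is a legitimate chart element: `R_{i+1} = (Rᵢ[𝔪ᵢ/u₀])_{𝔪_O ∩ Rᵢ[𝔪ᵢ/u₀]}` with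
  `v(u₀) = v(π)`, and `u₀/π` is a unit of `R_{i+1}`);
* `𝔪ᵢ = (π, y)` for some non-unit `y ∈ Rᵢ`, element-wise: every non-unit of `Rᵢ` is `a π + b y`
  with `a, b ∈ Rᵢ` (if `R_{i-1}` is two-dimensional, `𝔪ᵢ = (x, f)` with `x` the chart element of
  the step `R_{i-1} → Rᵢ` — `exists_maximalIdeal_eq_span_pair_of_step` — and `x = (x/π) · π`;
  if some member of the sequence is already the valuation ring `O`, then `𝔪ᵢ = (π)`).

All [folklore] (Zariski; Abhyankar 1956, §2; Huneke–Swanson 2006, Ch. 14).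
-/

set_option linter.dupNamespace false

namespace Summit.ResolutionOfSingularities.ResolutionOfSingularities.Theorems.PfaffLine.DiscreteFree

open IsLocalRing Literature.AlgebraicGeometry.Resolution

variable {K : Type} [Field K]

/-! ## Discrete rank one: `v(π)` is the largest value below `1` -/

/-- If every non-zero value is an integral power of `v(π)`, `0 < v(π) < 1`, then every value
`< 1` is `≤ v(π)`. [folklore] -/
theorem valuation_le_of_lt_one {O : ValuationSubring K} {π : K} (hπ1 : O.valuation π < 1)
    (hγ0 : O.valuation π ≠ 0)
    (hdisc : ∀ z : K, z ≠ 0 → ∃ n : ℤ, O.valuation z = O.valuation π ^ n)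
    {z : K} (hz : O.valuation z < 1) : O.valuation z ≤ O.valuation π := by
  by_cases hz0 : z = 0
  · rw [hz0, map_zero]; exact zero_le
  obtain ⟨n, hn⟩ := hdisc z hz0
  rw [hn] at hz ⊢
  have hγpos : 0 < O.valuation π := pos_iff_ne_zero.mpr hγ0
  have hn1 : (1 : ℤ) ≤ n := by
    have := (zpow_lt_one_iff_right_of_lt_one₀ hγpos hπ1).mp hz
    omega
  calc O.valuation π ^ n ≤ O.valuation π ^ (1 : ℤ) :=
        zpow_le_zpow_right_of_le_one₀ hγpos hπ1.le hn1
    _ = O.valuation π := zpow_one _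

/-- In the discrete setting, `v(π) ≠ 0` as soon as some non-zero element has value `< 1`.
[folklore] -/
theorem valuation_ne_zero_of_discrete {O : ValuationSubring K} {π x : K} (hx0 : x ≠ 0)
    (hx1 : O.valuation x < 1)
    (hdisc : ∀ z : K, z ≠ 0 → ∃ n : ℤ, O.valuation z = O.valuation π ^ n) :
    O.valuation π ≠ 0 := by
  intro hγ
  obtain ⟨n, hn⟩ := hdisc x hx0
  rw [hγ] at hn
  by_cases hn0 : n = 0
  · rw [hn0, zpow_zero] at hn
    rw [hn] at hx1
    exact lt_irrefl _ hx1
  · rw [zero_zpow n hn0] at hn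
    exact hx0 ((Valuation.zero_iff _).mp hn)

/-- A non-zero element of value `< 1` has its inverse outside every subring of `O`. [folklore] -/
theorem inv_not_mem_of_valuation_lt_one {O : ValuationSubring K} {S : Subring K}
    (hS : S ≤ O.toSubring) {π : K} (hπ1 : O.valuation π < 1) (hγ0 : O.valuation π ≠ 0) :
    π⁻¹ ∉ S := by
  intro h
  have h1 : O.valuation π⁻¹ ≤ 1 := (O.valuation_le_one_iff _).mpr (hS h)
  rw [map_inv₀, inv_le_one₀ (pos_iff_ne_zero.mpr hγ0)] at h1
  exact not_lt.mpr h1 hπ1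

/-! ## One step in the free `π`-chart regime -/

/-- **`π` is a legitimate chart element.** If `R₁` is the quadratic transform of `R` along `O`
(`O` dominating `R`), `π ∈ R` has value `< 1`, non-zero, and the largest value among values
`< 1`, then `z/π ∈ R₁` for every non-unit `z` of `R`: with `R₁ = (R[𝔪/u₀])_{𝔪_O ∩ R[𝔪/u₀]}`,
`v(u₀) = v(π)`, so `u₀/π = (π/u₀)⁻¹ ∈ R₁` and `z/π = (z/u₀)(u₀/π)`. [folklore] -/
theorem div_mem_of_step {O : ValuationSubring K} {R R₁ : Subring K} {π : K}
    (h : IsQuadraticTransformAlong O R R₁) (hO : SubringDominates R O.toSubring) (hπR : π ∈ R)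
    (hπ1 : O.valuation π < 1) (hγ0 : O.valuation π ≠ 0)
    (hmax : ∀ z : K, O.valuation z < 1 → O.valuation z ≤ O.valuation π)
    {z : K} (hz : z ∈ R) (hzinv : z⁻¹ ∉ R) : z / π ∈ R₁ := by
  obtain ⟨_, x, hxm, hx0, hxmax, rfl⟩ := h.exists_eq_locAtCentre
  have hπ0 : π ≠ 0 := (Valuation.ne_zero_iff _).mp hγ0
  have hx0K : ((x : R) : K) ≠ 0 := fun e => hx0 (Subtype.ext e)
  have hxinv : ((x : R) : K)⁻¹ ∉ R := fun hi =>
    ((mem_maximalIdeal_iff_inv_not_mem x).mp hxm).elim hx0K (· hi)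
  have hπinv : π⁻¹ ∉ R := inv_not_mem_of_valuation_lt_one hO.1 hπ1 hγ0
  have hπm : (⟨π, hπR⟩ : R) ∈ maximalIdeal R :=
    (mem_maximalIdeal_iff_inv_not_mem _).mpr (Or.inr hπinv)
  have hzm : (⟨z, hz⟩ : R) ∈ maximalIdeal R :=
    (mem_maximalIdeal_iff_inv_not_mem _).mpr (Or.inr hzinv)
  -- `v(x) = v(π)`
  have hvx1 : O.valuation (x : K) < 1 := valuation_lt_one_of_subringDominates hO x.2 hxinv
  have hvx : O.valuation ((x : R) : K) = O.valuation π :=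
    le_antisymm (hmax _ hvx1) (hxmax ⟨π, hπR⟩ hπm)
  -- `x/π ∈ R₁`
  have h1 : π / ((x : R) : K) ∈ blowupRing R ((x : R) : K) := div_mem_blowupRing (x : K) hπm
  have hv1 : O.valuation (π / ((x : R) : K)) = 1 := by
    rw [map_div₀, hvx, div_self hγ0]
  have hxπ : ((x : R) : K) / π ∈ locAtCentre (blowupRing R ((x : R) : K)) O := by
    have := inv_mem_locAtCentre (le_locAtCentre _ O h1) hv1
    rwa [inv_div] at this
  have hzx : z / ((x : R) : K) ∈ locAtCentre (blowupRing R ((x : R) : K)) O :=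
    le_locAtCentre _ O (div_mem_blowupRing (x : K) hzm)
  have e : z / π = z / ((x : R) : K) * (((x : R) : K) / π) := by
    field_simp
  rw [e]
  exact Subring.mul_mem _ hzx hxπ

/-- **`𝔪_{R₁} = (π, y)` element-wise, two-dimensional source.** If `R₁` is the quadratic
transform along `O` of the two-dimensional regular local ring `R` (dominated by `O`), every
non-unit `z` of `R` has `z/π ∈ R₁`, and `π` is a non-unit of `R₁`, then for some non-unit
`y ∈ R₁` every non-unit of `R₁` is `a π + b y` (`a, b ∈ R₁`): `𝔪_{R₁} = (x, f)` with `x ∈ 𝔪_R`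
(`exists_maximalIdeal_eq_span_pair_of_step`) and `x = (x/π) π`. [folklore] -/
theorem exists_span_pair_of_step {O : ValuationSubring K} {R R₁ : Subring K} {π : K}
    [IsRegularLocalRing R] (hdim : ringKrullDim R = 2) (h : IsQuadraticTransformAlong O R R₁)
    (hO : SubringDominates R O.toSubring) (hπ0 : π ≠ 0)
    (hB : ∀ z : K, z ∈ R → z⁻¹ ∉ R → z / π ∈ R₁) (hπR₁ : π ∈ R₁) (hπinv : π⁻¹ ∉ R₁) :
    ∃ y : K, y ∈ R₁ ∧ y⁻¹ ∉ R₁ ∧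
      ∀ z : K, z ∈ R₁ → z⁻¹ ∉ R₁ → ∃ a ∈ R₁, ∃ b ∈ R₁, z = a * π + b * y := by
  haveI := h.isLocalRing
  obtain ⟨x, f, hxR, hxinv, hm⟩ := CurveMono.exists_maximalIdeal_eq_span_pair_of_step hdim hO h
  have hxπ : (x : K) / π ∈ R₁ := hB _ hxR hxinv
  have key : ∀ z : K, z ∈ R₁ → z⁻¹ ∉ R₁ → ∃ a ∈ R₁, ∃ b ∈ R₁, z = a * π + b * f := by
    intro z hz hzinv
    have hzm : (⟨z, hz⟩ : R₁) ∈ maximalIdeal R₁ :=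
      (mem_maximalIdeal_iff_inv_not_mem _).mpr (Or.inr hzinv)
    rw [hm, Ideal.mem_span_pair] at hzm
    obtain ⟨a, b, hab⟩ := hzm
    refine ⟨a * ((x : K) / π), R₁.mul_mem a.2 hxπ, b, b.2, ?_⟩
    have e := congrArg (fun w : R₁ => (w : K)) hab
    simp only [Subring.coe_add, Subring.coe_mul] at e
    rw [← e]
    field_simp
  by_cases hf : (f : K)⁻¹ ∈ R₁
  · -- then `f = 0` and `𝔪_{R₁} = (x) = (π)`
    have hfm : f ∈ maximalIdeal R₁ := hm ▸ Ideal.subset_span (by simp)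
    have hf0 : (f : K) = 0 :=
      ((mem_maximalIdeal_iff_inv_not_mem f).mp hfm).elim id fun h' => absurd hf h'
    refine ⟨π, hπR₁, hπinv, fun z hz hzinv => ?_⟩
    obtain ⟨a, ha, b, -, e⟩ := key z hz hzinv
    refine ⟨a, ha, 0, R₁.zero_mem, ?_⟩
    rw [e, hf0]
    ring
  · exact ⟨f, f.2, hf, key⟩

/-- **The stationary case.** If `S ⊆ O` is dominated by `O` and is already a valuation ring of
`K` (`z ∈ S` or `z⁻¹ ∈ S` for all `z`), then `O ⊆ S`; so for `π` of largest value `< 1`, every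
non-unit `z` of `S` has `z/π ∈ S` and `z = (z/π) π + 0 · π`. [folklore] -/
theorem div_mem_of_forall_mem_or_inv_mem {O : ValuationSubring K} {S : Subring K} {π : K}
    (hval : ∀ z : K, z ∈ S ∨ z⁻¹ ∈ S) (hSO : SubringDominates S O.toSubring)
    (hγ0 : O.valuation π ≠ 0)
    (hmax : ∀ z : K, O.valuation z < 1 → O.valuation z ≤ O.valuation π)
    {z : K} (hz : z ∈ S) (hzinv : z⁻¹ ∉ S) : z / π ∈ S := by
  have hOS : ∀ w : K, w ∈ O → w ∈ S := by
    intro w hw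
    rcases hval w with h | h
    · exact h
    · have := hSO.2 w⁻¹ h (by rw [inv_inv]; exact hw)
      rwa [inv_inv] at this
  have hvz : O.valuation z < 1 := valuation_lt_one_of_subringDominates hSO hz hzinv
  refine hOS _ ?_
  rw [← O.valuation_le_one_iff, map_div₀, div_le_one₀ (pos_iff_ne_zero.mpr hγ0)]
  exact hmax z hvz

/-! ## The dichotomy along the sequence -/

/-- Along the quadratic sequence of a two-dimensional regular local ring of `K`, every member is
either again a two-dimensional (regular) local ring of `K` or already a valuation ring of `K`
(Huneke–Swanson, proof of Thm. 14.5.2). [folklore] -/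
theorem dichotomy_sequence {O : ValuationSubring K} {R : ℕ → Subring K}
    (hreg : IsRegularLocalRing (R 0)) (hdim : ringKrullDim (R 0) = 2) (hof : IsLocalRingOf (R 0))
    (h0 : SubringDominates (R 0) O.toSubring)
    (hstep : ∀ i, IsQuadraticTransformAlong O (R i) (R (i + 1))) (i : ℕ) :
    (ringKrullDim (R i) = 2 ∧ IsLocalRingOf (R i)) ∨ (∀ z : K, z ∈ R i ∨ z⁻¹ ∈ R i) := by
  induction i with
  | zero => exact Or.inl ⟨hdim, hof⟩
  | succ i ih =>
    rcases ih with ⟨hdimi, hofi⟩ | hval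
    · haveI := isRegularLocalRing_sequence hreg hstep i
      have hqt := (hstep i).isQuadraticTransform (sequence_dominates h0 hstep i).1
      rcases hqt.mem_or_inv_mem_or_isRegularLocalRing hdimi hofi with hv | ⟨-, hd⟩
      · exact Or.inr hv
      · exact Or.inl ⟨hd, hqt.isLocalRingOf hofi⟩
    · exact Or.inr fun z => (hval z).imp (fun hz => (hstep i).le hz) (fun hz => (hstep i).le hz)

end Summit.ResolutionOfSingularities.ResolutionOfSingularities.Theorems.PfaffLine.DiscreteFree

namespace Summit.ResolutionOfSingularities.ResolutionOfSingularities.Theorems.PfaffLine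

open IsLocalRing Literature.AlgebraicGeometry.Resolution DiscreteFree

/-- **The free `π`-chart regime** (registered helper stub `discreteSequence_freeRegime` of the
line `pfaff-line-log-final-forms`). For the quadratic sequence `R₀ → R₁ → ⋯` of a
two-dimensional regular local ring `R₀` of `K'` along a valuation ring `O'` dominating it, and
`π ∈ 𝔪_{O'}` such that every non-zero value is an integral power of `v(π)` (discrete rank one):
from some stage `i₀` on, `π ∈ Rᵢ` (Abhyankar's union lemma), every non-unit `z` of `Rᵢ` has
`z/π ∈ R_{i+1}` (`π` has the largest value among non-units, so it is a chart element), and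
`𝔪ᵢ = (π, y)` element-wise for some non-unit `y ∈ Rᵢ`. [folklore] -/
theorem discreteSequence_freeRegime :
    ∀ (K' : Type) [Field K'] (O' : ValuationSubring K') (R : ℕ → Subring K') (π : K'), IsRegularLocalRing (R 0) → ringKrullDim (R 0) = 2 → Literature.AlgebraicGeometry.Resolution.IsLocalRingOf (R 0) → Literature.AlgebraicGeometry.Resolution.SubringDominates (R 0) O'.toSubring → (∀ i, Literature.AlgebraicGeometry.Resolution.IsQuadraticTransformAlong O' (R i) (R (i + 1))) → π ∈ O' → O'.valuation π < 1 → (∀ z : K', z ≠ 0 → ∃ n : ℤ, O'.valuation z = O'.valuation π ^ n) → ∃ i₀ : ℕ, ∀ i : ℕ, i₀ ≤ i → π ∈ R i ∧ (∀ z : K', z ∈ R i → z⁻¹ ∉ R i → z / π ∈ R (i + 1)) ∧ ∃ y : K', y ∈ R i ∧ y⁻¹ ∉ R i ∧ ∀ z : K', z ∈ R i → z⁻¹ ∉ R i → ∃ a ∈ R i, ∃ b ∈ R i, z = a * π + b * y := by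
  intro K' _ O' R π hreg hdim hof hdom hstep hπO hπ1 hdisc
  have hdomO : ∀ i, SubringDominates (R i) O'.toSubring := fun i =>
    (sequence_dominates hdom hstep i).1
  have hmono : Monotone R := sequence_monotone hstep
  -- `v(π) ≠ 0`, from a non-zero non-unit of `R 0`
  obtain ⟨x₀, hx₀, hx₀0, hx₀inv, -⟩ := exists_generator_of_step hstep 0
  have hγ0 : O'.valuation π ≠ 0 :=
    valuation_ne_zero_of_discrete hx₀0 (valuation_lt_one_of_subringDominates hdom hx₀ hx₀inv) hdisc
  have hπ0 : π ≠ 0 := (Valuation.ne_zero_iff _).mp hγ0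
  -- `v(π)` is the largest value `< 1`
  have hmax : ∀ z : K', O'.valuation z < 1 → O'.valuation z ≤ O'.valuation π := fun z hz =>
    valuation_le_of_lt_one hπ1 hγ0 hdisc hz
  -- Abhyankar's union lemma: `π ∈ R i₁`
  obtain ⟨i₁, hi₁⟩ := (AbhyankarQuadraticUnion_holds K' O' R hreg hdim hof hdom hstep π).mp hπO
  have hπR : ∀ i, i₁ ≤ i → π ∈ R i := fun i hi => hmono hi hi₁
  have hπinv : ∀ i, π⁻¹ ∉ R i := fun i => inv_not_mem_of_valuation_lt_one (hdomO i).1 hπ1 hγ0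
  -- (B) from stage `i₁` on
  have hB : ∀ i, i₁ ≤ i → ∀ z : K', z ∈ R i → z⁻¹ ∉ R i → z / π ∈ R (i + 1) :=
    fun i hi z hz hzinv => div_mem_of_step (hstep i) (hdomO i) (hπR i hi) hπ1 hγ0 hmax hz hzinv
  refine ⟨i₁ + 1, fun i hi => ⟨hπR i (by omega), hB i (by omega), ?_⟩⟩
  obtain ⟨j, rfl⟩ : ∃ j, i = j + 1 := ⟨i - 1, by omega⟩
  have hj : i₁ ≤ j := by omega
  rcases dichotomy_sequence hreg hdim hof hdom hstep j with ⟨hdimj, -⟩ | hval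
  · haveI := isRegularLocalRing_sequence hreg hstep j
    exact exists_span_pair_of_step hdimj (hstep j) (hdomO j) hπ0 (hB j hj) (hπR (j + 1) (by omega))
      (hπinv (j + 1))
  · have hval' : ∀ z : K', z ∈ R (j + 1) ∨ z⁻¹ ∈ R (j + 1) := fun z =>
      (hval z).imp (fun hz => (hstep j).le hz) (fun hz => (hstep j).le hz)
    refine ⟨π, hπR (j + 1) (by omega), hπinv (j + 1), fun z hz hzinv => ?_⟩
    refine ⟨z / π, div_mem_of_forall_mem_or_inv_mem hval' (hdomO (j + 1)) hγ0 hmax hz hzinv, 0,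
      (R (j + 1)).zero_mem, ?_⟩
    rw [div_mul_cancel₀ _ hπ0, zero_mul, add_zero]

end Summit.ResolutionOfSingularities.ResolutionOfSingularities.Theorems.PfaffLine
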